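import Literature.Combinatorics.Optimization.TracialDesigns
import HarnessLib

/-!
# Cell pnp-psdrank, route `ChebyshevTracialDesign`: SCALAR PEELING — the full-rank part of a tight psd strategy is a tight
# one-dimensional rectangle, so the open core only concerns SINGULAR (rank-deficient) strategies

Structural normal form for the crux `TracialDecayExp20` (stmt-PneNP-19878), brick 58 (prover g11; MEMO-14 §5 (a) Step 1, the first step of the
synchronisation / incidence line for the dense non-crossing psd cell). Let `(X, Y)` be a tight-orthogonal psd rectangle of dimension `r`
(`IsPsdRect`) and `λ_U ≥ 0` any lower spectral bound of the cut side, `X_U ⪰ λ_U·I` (e.g. `λ_U = λ_min(X_U)`). Put `X'_U := X_U − λ_U·I`. Then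
* `isPsdRect_peel_left` — `(X', Y)` is again a tight-orthogonal psd rectangle: on a tight pair with `λ_U > 0` the matrix `X_U ⪰ λ_U I` is positive
  DEFINITE, so `X_U Y_M = 0` forces `Y_M = 0` (`mul_eq_zero_of_tight_of_pos`);
* `value_peel_left_eq` — `Σ W(U,M)·tr(X_U Y_M) = Σ W(U,M)·tr(X'_U Y_M) + Σ W(U,M)·λ_U·tr(Y_M)`;
* `scalar_part_le` — the peeled part is a TIGHT ONE-DIMENSIONAL RECTANGLE `(λ_U) × (tr(Y_M)/r)` (entries in `[0,1]`, vanishing product on the tight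
  pairs), so `Σ W(U,M)·λ_U·tr(Y_M) ≤ r·γ` whenever `TracialValueLEAt W γ 1` (the `r = 1` rung: every tight `[0,1]`-rectangle has value `≤ γ`);
* `value_le_peel_left` — hence `Σ W·tr(X_U Y_M) ≤ Σ W·tr(X'_U Y_M) + r·γ`: up to the `r = 1` rung one may assume the cut side is peeled, i.e.
  (with `λ = λ_min`) every `X_U` SINGULAR; `…_right` versions for the matching side.
Reading (MEMO-14 §5): at `r = 2` the singular normal form makes both sides rank `≤ 1`, tightness becomes angle synchronisation `θ_U = φ_M` on the
active tight pairs, and the dense cell follows from the quantitative spectral non-tightness by a monochromaticity argument; in general `r` the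
peeling is the entry point of the incidence-rigidity line. [cite: BrietDadushPokutta2014, Thm. 6 (§3)] [cite: GriblingDelaatLaurent2019, §5]
Stature: support/instrument (no defs). WHAT THIS IS NOT: no estimate on the dense cell, nothing on psd rank, no P-vs-NP content. Supports stmt-PneNP-19878.
-/

set_option linter.dupNamespace false -- `Summit.PneNP.PneNP.…`: summit = sub-problem (D-0017)

noncomputable section

namespace Summit.PneNP.PneNP.Theorems.ChebyshevTracialDesignScalarPeeling

open Finset Matrix Literature.Barriers.PneNP Literature.Combinatorics.Optimization

variable {n r : ℕ}

/-! ### §1 Positive definite cut operators kill their tight partners -/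

/-- If `X ⪰ λ·I` with `λ > 0` then `X` is positive definite. [folklore] -/
theorem posDef_of_lowerBound {X : Matrix (Fin r) (Fin r) ℝ} {lam : ℝ} (hlam : 0 < lam) (hX : (X - lam • (1 : Matrix (Fin r) (Fin r) ℝ)).PosSemidef) :
    X.PosDef := by
  have h1 : (lam • (1 : Matrix (Fin r) (Fin r) ℝ)).PosDef := PosDef.one.smul hlam
  have h := h1.add_posSemidef hX
  rwa [add_sub_cancel] at h

/-- **A positive definite operator has no nonzero tight partner**: `X Y = 0` with `X ⪰ λ I`, `λ > 0` forces `Y = 0`. [folklore] -/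
theorem mul_eq_zero_of_tight_of_pos {X Y : Matrix (Fin r) (Fin r) ℝ} {lam : ℝ} (hlam : 0 < lam)
    (hX : (X - lam • (1 : Matrix (Fin r) (Fin r) ℝ)).PosSemidef) (hXY : X * Y = 0) : Y = 0 := by
  have hU : IsUnit X.det := (isUnit_iff_isUnit_det X).1 (posDef_of_lowerBound hlam hX).isUnit
  have h := nonsing_inv_mul_cancel_left X Y hU
  rw [hXY, Matrix.mul_zero] at h
  exact h.symm

/-- A lower spectral bound of a contraction is at most `1` (when `r ≥ 1`). [folklore] -/
theorem lowerBound_le_one (hr : 0 < r) {X : Matrix (Fin r) (Fin r) ℝ} {lam : ℝ}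
    (hX : (X - lam • (1 : Matrix (Fin r) (Fin r) ℝ)).PosSemidef) (hX1 : (1 - X).PosSemidef) : lam ≤ 1 := by
  have h := (hX.add hX1).trace_nonneg
  have hsum : X - lam • (1 : Matrix (Fin r) (Fin r) ℝ) + (1 - X) = (1 - lam) • (1 : Matrix (Fin r) (Fin r) ℝ) := by
    rw [sub_smul, one_smul]; abel
  rw [hsum, trace_smul, trace_one, Fintype.card_fin, smul_eq_mul] at h
  have hr' : (0 : ℝ) < r := by exact_mod_cast hr
  nlinarith

/-! ### §2 Peeling the cut side -/

/-- **Peeling a scalar lower bound off the cut side keeps a tight-orthogonal psd rectangle tight-orthogonal and psd.** For `(X, Y)` with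
`IsPsdRect X Y` and `0 ≤ λ_U` with `X_U ⪰ λ_U I`: `IsPsdRect (U ↦ X_U − λ_U I) Y`. [cite: BrietDadushPokutta2014, Thm. 6 (§3)] -/
theorem isPsdRect_peel_left {X : OddSet n → Matrix (Fin r) (Fin r) ℝ} {Y : PMatch n → Matrix (Fin r) (Fin r) ℝ} (hXY : IsPsdRect X Y)
    {lam : OddSet n → ℝ} (hlam0 : ∀ U, 0 ≤ lam U) (hlam : ∀ U, (X U - lam U • (1 : Matrix (Fin r) (Fin r) ℝ)).PosSemidef) :
    IsPsdRect (fun U => X U - lam U • (1 : Matrix (Fin r) (Fin r) ℝ)) Y := by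
  refine ⟨fun U => ⟨hlam U, ?_⟩, hXY.2.1, fun U M hcc => ?_⟩
  · have h1 : (1 - (X U - lam U • (1 : Matrix (Fin r) (Fin r) ℝ))) = (1 - X U) + lam U • (1 : Matrix (Fin r) (Fin r) ℝ) := by abel
    rw [h1]
    exact (hXY.1 U).2.add (PosSemidef.one.smul (hlam0 U))
  · show (X U - lam U • (1 : Matrix (Fin r) (Fin r) ℝ)) * Y M = 0
    rcases (hlam0 U).eq_or_lt with h0 | hpos
    · rw [← h0, zero_smul, sub_zero]; exact hXY.2.2 U M hcc
    · rw [mul_eq_zero_of_tight_of_pos hpos (hlam U) (hXY.2.2 U M hcc), Matrix.mul_zero]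

/-- **The value splits**: `Σ W·tr(X_U Y_M) = Σ W·tr((X_U − λ_U I) Y_M) + Σ W·λ_U·tr(Y_M)`. [cite: GriblingDelaatLaurent2019, §5] -/
theorem value_peel_left_eq (W : OddSet n → PMatch n → ℝ) (X : OddSet n → Matrix (Fin r) (Fin r) ℝ)
    (Y : PMatch n → Matrix (Fin r) (Fin r) ℝ) (lam : OddSet n → ℝ) :
    ∑ U, ∑ M, W U M * (X U * Y M).trace =
      ∑ U, ∑ M, W U M * ((X U - lam U • (1 : Matrix (Fin r) (Fin r) ℝ)) * Y M).trace + ∑ U, ∑ M, W U M * (lam U * (Y M).trace) := by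
  rw [← sum_add_distrib]
  refine sum_congr rfl fun U _ => ?_
  rw [← sum_add_distrib]
  refine sum_congr rfl fun M _ => ?_
  rw [sub_mul, trace_sub, smul_mul_assoc, Matrix.one_mul, trace_smul, smul_eq_mul]
  ring

/-- **The peeled scalar part is a tight one-dimensional rectangle, hence `≤ r·γ` under the `r = 1` rung.** For a tight-orthogonal psd rectangle
`(X, Y)` of dimension `r ≥ 1`, `0 ≤ λ_U` with `X_U ⪰ λ_U I`, and a weight `W` with `TracialValueLEAt W γ 1`: `Σ W(U,M)·λ_U·tr(Y_M) ≤ r·γ`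
(the `1 × 1` pair `(λ_U)`, `(tr(Y_M)/r)` has entries in `[0,1]` and vanishing products on the tight pairs). [cite: GriblingDelaatLaurent2019, §5] -/
theorem scalar_part_le (hr : 0 < r) (W : OddSet n → PMatch n → ℝ) {γ : ℝ} (hγ : TracialValueLEAt W γ 1)
    {X : OddSet n → Matrix (Fin r) (Fin r) ℝ} {Y : PMatch n → Matrix (Fin r) (Fin r) ℝ} (hXY : IsPsdRect X Y)
    {lam : OddSet n → ℝ} (hlam0 : ∀ U, 0 ≤ lam U) (hlam : ∀ U, (X U - lam U • (1 : Matrix (Fin r) (Fin r) ℝ)).PosSemidef) :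
    ∑ U, ∑ M, W U M * (lam U * (Y M).trace) ≤ r * γ := by
  have hr' : (0 : ℝ) < r := by exact_mod_cast hr
  -- the one-dimensional tight rectangle
  set X₁ : OddSet n → Matrix (Fin 1) (Fin 1) ℝ := fun U => lam U • (1 : Matrix (Fin 1) (Fin 1) ℝ) with hX₁
  set Y₁ : PMatch n → Matrix (Fin 1) (Fin 1) ℝ := fun M => ((Y M).trace / r) • (1 : Matrix (Fin 1) (Fin 1) ℝ) with hY₁
  have htr0 : ∀ M, 0 ≤ (Y M).trace := fun M => (hXY.2.1 M).1.trace_nonneg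
  have htr1 : ∀ M, (Y M).trace / r ≤ 1 := fun M => by
    rw [div_le_one hr']
    have h := (hXY.2.1 M).2.trace_nonneg
    rw [trace_sub, trace_one, Fintype.card_fin] at h
    linarith
  have h1 : IsPsdRect X₁ Y₁ := by
    refine ⟨fun U => ⟨PosSemidef.one.smul (hlam0 U), ?_⟩, fun M => ⟨PosSemidef.one.smul (div_nonneg (htr0 M) hr'.le), ?_⟩, fun U M hcc => ?_⟩
    · have : (1 : Matrix (Fin 1) (Fin 1) ℝ) - lam U • 1 = (1 - lam U) • (1 : Matrix (Fin 1) (Fin 1) ℝ) := by rw [sub_smul, one_smul]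
      rw [this]
      exact PosSemidef.one.smul (by linarith [lowerBound_le_one hr (hlam U) (hXY.1 U).2])
    · have : (1 : Matrix (Fin 1) (Fin 1) ℝ) - ((Y M).trace / r) • 1 = (1 - (Y M).trace / r) • (1 : Matrix (Fin 1) (Fin 1) ℝ) := by
        rw [sub_smul, one_smul]
      rw [this]
      exact PosSemidef.one.smul (by linarith [htr1 M])
    · show lam U • (1 : Matrix (Fin 1) (Fin 1) ℝ) * (((Y M).trace / r) • 1) = 0
      rw [smul_mul_smul_comm, Matrix.one_mul]
      rcases (hlam0 U).eq_or_lt with h0 | hpos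
      · rw [← h0, zero_mul, zero_smul]
      · rw [mul_eq_zero_of_tight_of_pos hpos (hlam U) (hXY.2.2 U M hcc), trace_zero, zero_div, mul_zero, zero_smul]
  have h2 := hγ X₁ Y₁ h1
  rw [Nat.cast_one, div_one] at h2
  have h3 : ∑ U, ∑ M, W U M * (X₁ U * Y₁ M).trace = (∑ U, ∑ M, W U M * (lam U * (Y M).trace)) / r := by
    rw [sum_div]
    refine sum_congr rfl fun U _ => ?_
    rw [sum_div]
    refine sum_congr rfl fun M _ => ?_
    rw [hX₁, hY₁]
    dsimp only
    rw [smul_mul_smul_comm, Matrix.one_mul, trace_smul, trace_one, Fintype.card_fin, Nat.cast_one, smul_eq_mul, mul_one]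
    field_simp
  rw [h3, div_le_iff₀ hr'] at h2
  linarith

/-- **Up to the `r = 1` rung the cut side may be peeled**: `Σ W·tr(X_U Y_M) ≤ Σ W·tr((X_U − λ_U I) Y_M) + r·γ`. With `λ_U = λ_min(X_U)` the peeled
operators are singular. [cite: GriblingDelaatLaurent2019, §5] -/
theorem value_le_peel_left (hr : 0 < r) (W : OddSet n → PMatch n → ℝ) {γ : ℝ} (hγ : TracialValueLEAt W γ 1)
    {X : OddSet n → Matrix (Fin r) (Fin r) ℝ} {Y : PMatch n → Matrix (Fin r) (Fin r) ℝ} (hXY : IsPsdRect X Y)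
    {lam : OddSet n → ℝ} (hlam0 : ∀ U, 0 ≤ lam U) (hlam : ∀ U, (X U - lam U • (1 : Matrix (Fin r) (Fin r) ℝ)).PosSemidef) :
    ∑ U, ∑ M, W U M * (X U * Y M).trace ≤
      ∑ U, ∑ M, W U M * ((X U - lam U • (1 : Matrix (Fin r) (Fin r) ℝ)) * Y M).trace + r * γ := by
  rw [value_peel_left_eq W X Y lam]
  linarith [scalar_part_le hr W hγ hXY hlam0 hlam]

/-! ### §3 Peeling the matching side -/

/-- Peeling the matching side keeps `IsPsdRect`: for `0 ≤ κ_M`, `Y_M ⪰ κ_M I`: `IsPsdRect X (M ↦ Y_M − κ_M I)` (a tight pair with `κ_M > 0` has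
`X_U = 0`, by transposing `X_U Y_M = 0`). [cite: BrietDadushPokutta2014, Thm. 6 (§3)] -/
theorem isPsdRect_peel_right {X : OddSet n → Matrix (Fin r) (Fin r) ℝ} {Y : PMatch n → Matrix (Fin r) (Fin r) ℝ} (hXY : IsPsdRect X Y)
    {kap : PMatch n → ℝ} (hkap0 : ∀ M, 0 ≤ kap M) (hkap : ∀ M, (Y M - kap M • (1 : Matrix (Fin r) (Fin r) ℝ)).PosSemidef) :
    IsPsdRect X (fun M => Y M - kap M • (1 : Matrix (Fin r) (Fin r) ℝ)) := by
  refine ⟨hXY.1, fun M => ⟨hkap M, ?_⟩, fun U M hcc => ?_⟩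
  · have h1 : (1 - (Y M - kap M • (1 : Matrix (Fin r) (Fin r) ℝ))) = (1 - Y M) + kap M • (1 : Matrix (Fin r) (Fin r) ℝ) := by abel
    rw [h1]
    exact (hXY.2.1 M).2.add (PosSemidef.one.smul (hkap0 M))
  · show X U * (Y M - kap M • (1 : Matrix (Fin r) (Fin r) ℝ)) = 0
    rcases (hkap0 M).eq_or_lt with h0 | hpos
    · rw [← h0, zero_smul, sub_zero]; exact hXY.2.2 U M hcc
    · -- transpose: `Y_M X_U = 0`, `Y_M` positive definite ⇒ `X_U = 0`
      have hXs : (X U)ᵀ = X U := by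
        have h := (hXY.1 U).1.1; rwa [IsHermitian, conjTranspose_eq_transpose_of_trivial] at h
      have hYs : (Y M)ᵀ = Y M := by
        have h := (hXY.2.1 M).1.1; rwa [IsHermitian, conjTranspose_eq_transpose_of_trivial] at h
      have hYX : Y M * X U = 0 := by
        have h := congrArg transpose (hXY.2.2 U M hcc)
        rwa [transpose_mul, transpose_zero, hXs, hYs] at h
      rw [mul_eq_zero_of_tight_of_pos hpos (hkap M) hYX, Matrix.zero_mul]

/-- The value splits on the matching side: `Σ W·tr(X_U Y_M) = Σ W·tr(X_U (Y_M − κ_M I)) + Σ W·κ_M·tr(X_U)`. [cite: GriblingDelaatLaurent2019, §5] -/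
theorem value_peel_right_eq (W : OddSet n → PMatch n → ℝ) (X : OddSet n → Matrix (Fin r) (Fin r) ℝ)
    (Y : PMatch n → Matrix (Fin r) (Fin r) ℝ) (kap : PMatch n → ℝ) :
    ∑ U, ∑ M, W U M * (X U * Y M).trace =
      ∑ U, ∑ M, W U M * (X U * (Y M - kap M • (1 : Matrix (Fin r) (Fin r) ℝ))).trace + ∑ U, ∑ M, W U M * (kap M * (X U).trace) := by
  rw [← sum_add_distrib]
  refine sum_congr rfl fun U _ => ?_
  rw [← sum_add_distrib]
  refine sum_congr rfl fun M _ => ?_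
  rw [mul_sub, trace_sub, mul_smul_comm, Matrix.mul_one, trace_smul, smul_eq_mul]
  ring

/-- The peeled scalar part of the matching side is `≤ r·γ` under the `r = 1` rung (the `1 × 1` pair `(tr(X_U)/r)`, `(κ_M)`).
[cite: GriblingDelaatLaurent2019, §5] -/
theorem scalar_part_right_le (hr : 0 < r) (W : OddSet n → PMatch n → ℝ) {γ : ℝ} (hγ : TracialValueLEAt W γ 1)
    {X : OddSet n → Matrix (Fin r) (Fin r) ℝ} {Y : PMatch n → Matrix (Fin r) (Fin r) ℝ} (hXY : IsPsdRect X Y)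
    {kap : PMatch n → ℝ} (hkap0 : ∀ M, 0 ≤ kap M) (hkap : ∀ M, (Y M - kap M • (1 : Matrix (Fin r) (Fin r) ℝ)).PosSemidef) :
    ∑ U, ∑ M, W U M * (kap M * (X U).trace) ≤ r * γ := by
  have hr' : (0 : ℝ) < r := by exact_mod_cast hr
  set X₁ : OddSet n → Matrix (Fin 1) (Fin 1) ℝ := fun U => ((X U).trace / r) • (1 : Matrix (Fin 1) (Fin 1) ℝ) with hX₁
  set Y₁ : PMatch n → Matrix (Fin 1) (Fin 1) ℝ := fun M => kap M • (1 : Matrix (Fin 1) (Fin 1) ℝ) with hY₁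
  have htr0 : ∀ U, 0 ≤ (X U).trace := fun U => (hXY.1 U).1.trace_nonneg
  have htr1 : ∀ U, (X U).trace / r ≤ 1 := fun U => by
    rw [div_le_one hr']
    have h := (hXY.1 U).2.trace_nonneg
    rw [trace_sub, trace_one, Fintype.card_fin] at h
    linarith
  have hpeel := isPsdRect_peel_right hXY hkap0 hkap
  have h1 : IsPsdRect X₁ Y₁ := by
    refine ⟨fun U => ⟨PosSemidef.one.smul (div_nonneg (htr0 U) hr'.le), ?_⟩, fun M => ⟨PosSemidef.one.smul (hkap0 M), ?_⟩, fun U M hcc => ?_⟩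
    · have : (1 : Matrix (Fin 1) (Fin 1) ℝ) - ((X U).trace / r) • 1 = (1 - (X U).trace / r) • (1 : Matrix (Fin 1) (Fin 1) ℝ) := by
        rw [sub_smul, one_smul]
      rw [this]
      exact PosSemidef.one.smul (by linarith [htr1 U])
    · have : (1 : Matrix (Fin 1) (Fin 1) ℝ) - kap M • 1 = (1 - kap M) • (1 : Matrix (Fin 1) (Fin 1) ℝ) := by rw [sub_smul, one_smul]
      rw [this]
      exact PosSemidef.one.smul (by linarith [lowerBound_le_one hr (hkap M) (hXY.2.1 M).2])
    · show ((X U).trace / r) • (1 : Matrix (Fin 1) (Fin 1) ℝ) * (kap M • 1) = 0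
      rw [smul_mul_smul_comm, Matrix.one_mul]
      rcases (hkap0 M).eq_or_lt with h0 | hpos
      · rw [← h0, mul_zero, zero_smul]
      · -- on a tight pair with `κ_M > 0`, `X_U = X_U (Y_M − κ I) + κ X_U`, both products vanish ⇒ `X_U = 0`
        have hprod : X U * (Y M - kap M • (1 : Matrix (Fin r) (Fin r) ℝ)) = 0 := hpeel.2.2 U M hcc
        have hX0 : X U = 0 := by
          have h := hXY.2.2 U M hcc
          rw [mul_sub, h, zero_sub, neg_eq_zero, mul_smul_comm, Matrix.mul_one, smul_eq_zero] at hprod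
          exact hprod.resolve_left hpos.ne'
        rw [hX0, trace_zero, zero_div, zero_mul, zero_smul]
  have h2 := hγ X₁ Y₁ h1
  rw [Nat.cast_one, div_one] at h2
  have h3 : ∑ U, ∑ M, W U M * (X₁ U * Y₁ M).trace = (∑ U, ∑ M, W U M * (kap M * (X U).trace)) / r := by
    rw [sum_div]
    refine sum_congr rfl fun U _ => ?_
    rw [sum_div]
    refine sum_congr rfl fun M _ => ?_
    rw [hX₁, hY₁]
    dsimp only
    rw [smul_mul_smul_comm, Matrix.one_mul, trace_smul, trace_one, Fintype.card_fin, Nat.cast_one, smul_eq_mul, mul_one]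
    field_simp
  rw [h3, div_le_iff₀ hr'] at h2
  linarith

/-- **Up to the `r = 1` rung the matching side may be peeled**: `Σ W·tr(X_U Y_M) ≤ Σ W·tr(X_U (Y_M − κ_M I)) + r·γ`.
[cite: GriblingDelaatLaurent2019, §5] -/
theorem value_le_peel_right (hr : 0 < r) (W : OddSet n → PMatch n → ℝ) {γ : ℝ} (hγ : TracialValueLEAt W γ 1)
    {X : OddSet n → Matrix (Fin r) (Fin r) ℝ} {Y : PMatch n → Matrix (Fin r) (Fin r) ℝ} (hXY : IsPsdRect X Y)
    {kap : PMatch n → ℝ} (hkap0 : ∀ M, 0 ≤ kap M) (hkap : ∀ M, (Y M - kap M • (1 : Matrix (Fin r) (Fin r) ℝ)).PosSemidef) :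
    ∑ U, ∑ M, W U M * (X U * Y M).trace ≤
      ∑ U, ∑ M, W U M * (X U * (Y M - kap M • (1 : Matrix (Fin r) (Fin r) ℝ))).trace + r * γ := by
  rw [value_peel_right_eq W X Y kap]
  linarith [scalar_part_right_le hr W hγ hXY hkap0 hkap]

end Summit.PneNP.PneNP.Theorems.ChebyshevTracialDesignScalarPeeling
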